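import Literature.NumberTheory.Transcendental.ExpDominantSolvabilityContraction
import Literature.NumberTheory.Transcendental.ExpVarieties
import Literature.ModelTheory.ExponentialFields.Languages
import Summits.Schanuel.Schanuel.Theorems.ZilberEacComplexPunctureDecouplingLemmas
import Summits.Schanuel.Schanuel.Theorems.ZilberEacComplexGraphEscapeTopLemmas
import HarnessLib

/-!
# EC by escape over graph bases of any degree: fibres with polynomial top coefficients

Zilber's Exponential-Algebraic Closedness, range `dim π₁(V) = n - 1` (first open rung, Mantova–Masser,
PLMS 129 (2024), §1 p. 5), for the `(s+1)`-folds
`V = {x_{s+1} = g(x'), yⱼ = Tⱼ(x') y_{s+1}^{κⱼ} + Σ_{i<κⱼ} A_{j,i}(x') y_{s+1}^i (j ≤ s)}`, i.e. EVERY system of fibre polynomials `Pⱼ ∈ ℂ[x'][y_{s+1}]` over the graph of ANY `g` of total degree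
`D ≥ 2`, under the Zariski-open conditions `g_D(κ) ≠ 0`, `(Tⱼ)_{deg Tⱼ}(κ) ≠ 0` on leading forms
(`κⱼ = deg_{y_{s+1}} Pⱼ`). Constant `Tⱼ = cⱼ` is Theorem E_D (`ZilberEacComplexGraphEscape.lean`);
non-constant top coefficients (e.g. `y₁ = x₁y₃ + …`) were listed open in this packet's census.
Mechanism: escape with MOVING LOGARITHMS — `τ = e^{Λ}`, `Λ = log r + iθ₀ + η/D`,
`xⱼ = κⱼτ + dⱼΛ + log tⱼ + ζⱼ` (`dⱼ = deg Tⱼ`, `tⱼ = (Tⱼ)_{dⱼ}(κ)`), so that `e^{xⱼ} = tⱼ τ^{dⱼ} e^{κⱼτ} e^{ζⱼ}`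
matches `Tⱼ(x) e^{κⱼ g(x)}` up to `1 + O(logᴺ r / r)` (ray expansion), the escaping coordinate being an
unknown of the contraction `Literature.NumberTheory.Transcendental.ExpDominant.exists_exp_eq_one_add`.
* `exists_expPoint_graphEscape_top` — **EC for the class above** (Theorem E_D^top).
HONEST FRAMING: a modest new sub-rung of EAC; nothing here bears on Schanuel's conjecture.
-/

noncomputable section

open Complex MvPolynomial Metric Set Filter Topology

set_option linter.dupNamespace false

namespace Summit.Schanuel.Schanuel.Theorems

set_option maxHeartbeats 800000 in
/-- **EC by escape with polynomial top coefficients (Theorem E_D^top).** Let `g ∈ ℂ[x₁..xₛ]` have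
total degree `D ≥ 2` and leading form `g_D`, `κ ∈ ℕˢ` with `g_D(κ) ≠ 0`, and let `Tⱼ ∈ ℂ[x₁..xₛ]`
have leading forms with `(Tⱼ)_{deg Tⱼ}(κ) ≠ 0`; `A_{j,i}` arbitrary. Then the system
`exp xⱼ = Tⱼ(x) (e^{g(x)})^{κⱼ} + Σ_{i<κⱼ} A_{j,i}(x) (e^{g(x)})^i` (`j ≤ s`) has a solution `x ∈ ℂˢ`: the
`(s+1)`-fold `V = {x_{s+1} = g(x'), yⱼ = Tⱼ(x') y_{s+1}^{κⱼ} + Σ_{i<κⱼ} A_{j,i}(x') y_{s+1}^i}` (additive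
projection the graph hypersurface `x_{s+1} = g(x')`, `dim π₁ V = n - 1`, first open range of
Exponential-Algebraic Closedness, Mantova–Masser 2024 §1 p. 5) meets the graph of `exp` — every
fibre polynomial in `(x', y_{s+1})`, generic leading forms, NO lattice hypothesis. Generalizes
`exists_expPoint_graphEscape` (constant `Tⱼ`). New.
[cite: MantovaMasser2023, §1 p.5 (the open case dim π(V) = 2 in ℂ³×ℂˣ³)] -/
theorem exists_expPoint_graphEscape_top {s : ℕ} (g : MvPolynomial (Fin s) ℂ)
    (hD : 2 ≤ g.totalDegree) (κ : Fin s → ℕ)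
    (hα : eval (fun j => (κ j : ℂ)) (homogeneousComponent g.totalDegree g) ≠ 0)
    (T : Fin s → MvPolynomial (Fin s) ℂ)
    (hT : ∀ j, eval (fun j => (κ j : ℂ)) (homogeneousComponent (T j).totalDegree (T j)) ≠ 0)
    (A : Fin s → ℕ → MvPolynomial (Fin s) ℂ) :
    ∃ x : Fin s → ℂ, ∀ j,
      exp (x j) = eval x (T j) * exp (eval x g) ^ (κ j) +
        ∑ i ∈ Finset.range (κ j), eval x (A j i) * exp (eval x g) ^ i := by
  classical
  set D := g.totalDegree with hDdef
  set κc : Fin s → ℂ := fun j => (κ j : ℂ) with hκc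
  set α : ℂ := eval κc (homogeneousComponent D g) with hαdef
  have hαpos : 0 < ‖α‖ := norm_pos_iff.mpr hα
  have hD0 : D ≠ 0 := by omega
  have hDpos : 0 < D := by omega
  have hDC : (D : ℂ) ≠ 0 := by exact_mod_cast hD0
  set d : Fin s → ℕ := fun j => (T j).totalDegree with hd
  set t : Fin s → ℂ := fun j => eval κc (homogeneousComponent (d j) (T j)) with ht
  have ht0 : ∀ j, t j ≠ 0 := fun j => hT j
  set ℓ : Fin s → ℂ := fun j => log (t j) with hℓ
  have hexpℓ : ∀ j, exp (ℓ j) = t j := fun j => Complex.exp_log (ht0 j)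
  obtain ⟨σ, hσ, θ₀, hθ₀, hroot⟩ := exists_sign_arg_root hα hDpos
  obtain ⟨Cg, hCg0, Ng, hCg⟩ := exists_norm_eval_ray_sub_le g κc
  have hrayT := fun j => exists_norm_eval_ray_sub_le (T j) κc
  choose CT hCT0 NT hCT using hrayT
  have hgrowth := fun j i =>
    Literature.NumberTheory.Transcendental.HypersurfaceCover.exists_norm_eval_le_pow (A j i)
  choose CA hCA0 NA hCA using hgrowth
  set ε : ℝ := 1 / (16 * ((s : ℝ) + 2)) with hε
  have hεpos : 0 < ε := by positivity
  set c₁ : ℝ := ∑ j, (d j : ℝ) with hc₁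
  have hc₁0 : 0 ≤ c₁ := by positivity
  have hdc₁ : ∀ j, (d j : ℝ) ≤ c₁ := fun j =>
    Finset.single_le_sum (f := fun j => (d j : ℝ)) (fun i _ => by positivity) (Finset.mem_univ j)
  set c₂ : ℝ := c₁ * (Real.pi + 1) + ‖ℓ‖ + 1 with hc₂
  have hc₂0 : 0 ≤ c₂ := by positivity
  set W : ℝ → ℝ := fun r => c₁ * Real.log r + c₂ with hW
  set L : ℝ := 2 * ‖κc‖ + c₁ + c₂ + 1 with hL
  have hL0 : 0 ≤ L := by positivity
  set F : Fin s → ℝ → ℝ := fun j r =>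
    (CT j * (2 ^ d j * 2 ^ d j) * ((1 + c₁ * Real.log r + c₂) ^ NT j / r) +
      2 ^ d j * ∑ i ∈ Finset.range (κ j),
        CA j i * L ^ NA j i * ((1 + r) ^ NA j i * Real.exp (-(r / 12)))) / ‖t j‖ with hF
  set Fl : ℝ → ℝ := fun r =>
    (2 * ((1 + 0 * Real.log r + 0) ^ 0 / r) +
      Cg * 2 ^ (D - 1) * ((1 + c₁ * Real.log r + c₂) ^ Ng / r)) / ‖α‖ with hFl
  have hFt : ∀ j, Tendsto (F j) atTop (𝓝 0) := by
    intro j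
    have h1 := tendsto_finsetSum (Finset.range (κ j)) fun i _ =>
      (tendsto_one_add_pow_mul_exp_neg_div (NA j i)).const_mul (CA j i * L ^ NA j i)
    simp only [mul_zero, Finset.sum_const_zero] at h1
    have h2 := ((tendsto_one_add_log_pow_div hc₁0 hc₂0 (NT j)).const_mul
      (CT j * (2 ^ d j * 2 ^ d j))).add (h1.const_mul (2 ^ d j))
    rw [mul_zero, mul_zero, add_zero] at h2
    have h3 := h2.div_const ‖t j‖
    rwa [zero_div] at h3
  have hFlt : Tendsto Fl atTop (𝓝 0) := by
    have h2 := ((tendsto_one_add_log_pow_div le_rfl le_rfl 0).const_mul 2).add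
      ((tendsto_one_add_log_pow_div hc₁0 hc₂0 Ng).const_mul (Cg * 2 ^ (D - 1)))
    rw [mul_zero, mul_zero, add_zero] at h2
    have h3 := h2.div_const ‖α‖
    rwa [zero_div] at h3
  have hev : ∀ᶠ r : ℝ in atTop, ((∀ j, F j r ≤ ε) ∧ Fl r ≤ ε) ∧ 2 ≤ r := by
    refine ((eventually_all.2 fun j => ?_).and ?_).and (eventually_ge_atTop _)
    · exact (hFt j).eventually (ge_mem_nhds hεpos)
    · exact hFlt.eventually (ge_mem_nhds hεpos)
  obtain ⟨R, hR⟩ := Filter.eventually_atTop.mp hev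
  obtain ⟨k, hk0, hRr⟩ := exists_nat_escape_radius hαpos hD0 R
  set r : ℝ := (2 * Real.pi * k / ‖α‖) ^ ((D : ℝ)⁻¹) with hr
  have hbase : 0 ≤ 2 * Real.pi * k / ‖α‖ := by positivity
  have hrD : r ^ D = 2 * Real.pi * k / ‖α‖ := Real.rpow_inv_natCast_pow hbase hD0
  obtain ⟨⟨hFε, hFlε⟩, hr2⟩ := hR r hRr
  have hrpos : 0 < r := by linarith
  have hr0 : 0 ≤ r := hrpos.le; have hr1 : 1 ≤ r := by linarith
  have hlogr : 0 ≤ Real.log r := Real.log_nonneg hr1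
  have hlogr' : Real.log r ≤ r := (Real.log_le_sub_one_of_pos hrpos).trans (by linarith)
  set τ₀ : ℂ := (r : ℂ) * exp (θ₀ * I) with hτ₀
  set K₀ : ℂ := ((2 * Real.pi * k * σ : ℝ) : ℂ) * I with hK₀
  have hK₀eq : α * τ₀ ^ D = K₀ := by
    have hαC : ((‖α‖ : ℝ) : ℂ) ≠ 0 := by exact_mod_cast hαpos.ne'
    have h1 : (r : ℂ) ^ D = ((2 * Real.pi * k / ‖α‖ : ℝ) : ℂ) := by
      rw [← Complex.ofReal_pow, hrD]
    calc α * τ₀ ^ D = (r : ℂ) ^ D * (α * exp (θ₀ * I) ^ D) := by rw [hτ₀, mul_pow]; ring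
      _ = ((2 * Real.pi * k / ‖α‖ : ℝ) : ℂ) * (I * σ * ‖α‖) := by rw [h1, hroot]
      _ = K₀ := by
          rw [hK₀]
          push_cast
          rw [div_mul_eq_mul_div, div_eq_iff hαC]
          ring
  have hK₀norm' : ‖K₀‖ = ‖α‖ * r ^ D := by
    rw [hK₀, latticeConst_norm hσ, hrD]; field_simp
  have hK₀pos : 0 < ‖K₀‖ := by rw [hK₀norm']; positivity
  have hK₀0 : K₀ ≠ 0 := norm_pos_iff.mp hK₀pos
  have hexpK₀ : exp K₀ = 1 := latticeConst_exp hσ k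
  set Λf : (Fin (s + 1) → ℂ) → ℂ := fun ξ =>
    (Real.log r : ℂ) + θ₀ * I + ξ (Fin.last s) * (D : ℂ)⁻¹ with hΛf
  set τf : (Fin (s + 1) → ℂ) → ℂ := fun ξ => exp (Λf ξ) with hτf
  set wf : (Fin (s + 1) → ℂ) → (Fin s → ℂ) := fun ξ j =>
    (d j : ℂ) * Λf ξ + ℓ j + ξ (Fin.castSucc j) with hwf
  set xf : (Fin (s + 1) → ℂ) → (Fin s → ℂ) := fun ξ => τf ξ • κc + wf ξ with hxf
  set Gj : Fin s → (Fin (s + 1) → ℂ) → ℂ := fun j ξ =>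
    (eval (xf ξ) (T j) - t j * τf ξ ^ d j +
      ∑ i ∈ Finset.range (κ j), eval (xf ξ) (A j i) * exp (-(((κ j - i : ℕ) : ℂ) * τf ξ))) *
      (t j * τf ξ ^ d j)⁻¹ with hGj
  set Gl : (Fin (s + 1) → ℂ) → ℂ := fun ξ =>
    (τf ξ + α * τf ξ ^ D - eval (xf ξ) g) * K₀⁻¹ with hGl
  set G : Fin (s + 1) → (Fin (s + 1) → ℂ) → ℂ :=
    Fin.snoc (α := fun _ => (Fin (s + 1) → ℂ) → ℂ) Gj Gl with hG
  have hΛf_diff : Differentiable ℂ Λf := by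
    have h1 : Differentiable ℂ (fun ξ : Fin (s + 1) → ℂ => ξ (Fin.last s)) :=
      differentiable_apply _
    have h2 := (h1.mul_const ((D : ℂ)⁻¹)).const_add ((Real.log r : ℂ) + θ₀ * I)
    exact h2
  have hτf_diff : Differentiable ℂ τf := hΛf_diff.cexp
  have hτf_ne : ∀ ξ, τf ξ ≠ 0 := fun ξ => Complex.exp_ne_zero _
  have hxf_diff : ∀ i, Differentiable ℂ fun ξ => xf ξ i := by
    intro i
    have h1 : Differentiable ℂ (fun ξ : Fin (s + 1) → ℂ => ξ (Fin.castSucc i)) :=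
      differentiable_apply _
    have h2 := (hτf_diff.mul_const (κc i)).add
      (((hΛf_diff.const_mul (d i : ℂ)).add_const (ℓ i)).add h1)
    exact h2
  have heval_diff : ∀ p : MvPolynomial (Fin s) ℂ, Differentiable ℂ fun ξ => eval (xf ξ) p :=
    fun p ξ => DifferentiableAt.mvPolynomial_eval p fun i => (hxf_diff i) ξ
  have hG_diff : ∀ j, Differentiable ℂ (G j) := by
    intro j
    refine Fin.lastCases ?_ (fun j => ?_) j
    · have h2 := ((hτf_diff.add ((hτf_diff.pow D).const_mul α)).sub (heval_diff g)).mul_const K₀⁻¹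
      simp only [hG, Fin.snoc_last]
      exact h2
    · have h3 := fun i (_ : i ∈ Finset.range (κ j)) =>
        (heval_diff (A j i)).mul ((hτf_diff.const_mul (((κ j - i : ℕ) : ℂ))).neg.cexp)
      have h5 : Differentiable ℂ fun ξ => (t j * τf ξ ^ d j)⁻¹ :=
        ((hτf_diff.pow (d j)).const_mul (t j)).inv fun ξ =>
          mul_ne_zero (ht0 j) (pow_ne_zero _ (hτf_ne ξ))
      have h4 := (((heval_diff (T j)).sub ((hτf_diff.pow (d j)).const_mul (t j))).add
        (Differentiable.fun_sum h3)).mul h5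
      simp only [hG, Fin.snoc_castSucc]
      exact h4
  have hball : ∀ ξ ∈ ball (0 : Fin (s + 1) → ℂ) 1,
      ‖ξ (Fin.last s)‖ ≤ 1 ∧ ∀ i, ‖ξ (Fin.castSucc i)‖ ≤ 1 := by
    intro ξ hξ
    rw [mem_ball, dist_zero_right] at hξ
    exact ⟨(norm_le_pi_norm ξ _).trans hξ.le, fun i => (norm_le_pi_norm ξ _).trans hξ.le⟩
  have hθπ : |θ₀| ≤ Real.pi := hθ₀.trans (by
    rw [div_le_iff₀ (by positivity)]
    nlinarith [Real.pi_pos, (show (1 : ℝ) ≤ D by exact_mod_cast hDpos)])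
  have hτfacts : ∀ ξ ∈ ball (0 : Fin (s + 1) → ℂ) 1,
      r / 12 ≤ (τf ξ).re ∧ r / 2 ≤ ‖τf ξ‖ ∧ ‖τf ξ‖ ≤ 2 * r ∧
        ‖Λf ξ‖ ≤ Real.log r + Real.pi + 1 := by
    intro ξ hξ
    have hη := (hball ξ hξ).1
    obtain ⟨e1, e2⟩ := exp_logCoord r θ₀ (ξ (Fin.last s)) D hDpos
    have e : τf ξ = (r : ℂ) * exp (θ₀ * I) * exp (ξ (Fin.last s) / D) := by
      simp only [hτf, hΛf, e1, Real.exp_log hrpos]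
    rw [e]
    refine ⟨re_escape_ge hD hθ₀ hr0 hη, (norm_escape_le hD θ₀ hr0 hη).1,
      (norm_escape_le hD θ₀ hr0 hη).2, e2.trans ?_⟩
    rw [abs_of_nonneg hlogr]
    linarith
  have hwbound : ∀ ξ ∈ ball (0 : Fin (s + 1) → ℂ) 1, ‖wf ξ‖ ≤ W r := by
    intro ξ hξ
    obtain ⟨-, -, -, hΛ⟩ := hτfacts ξ hξ
    have hζ := (hball ξ hξ).2
    rw [pi_norm_le_iff_of_nonneg (by positivity)]
    intro j
    simp only [hwf]
    have h1 : ‖(d j : ℂ) * Λf ξ‖ ≤ c₁ * (Real.log r + Real.pi + 1) := by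
      rw [norm_mul, Complex.norm_natCast]
      exact mul_le_mul (hdc₁ j) hΛ (norm_nonneg _) hc₁0
    have h2 : ‖ℓ j‖ ≤ ‖ℓ‖ := norm_le_pi_norm ℓ j
    calc ‖(d j : ℂ) * Λf ξ + ℓ j + ξ (Fin.castSucc j)‖
        ≤ ‖(d j : ℂ) * Λf ξ‖ + ‖ℓ j‖ + ‖ξ (Fin.castSucc j)‖ := norm_add₃_le
      _ ≤ c₁ * (Real.log r + Real.pi + 1) + ‖ℓ‖ + 1 := by linarith [hζ j]
      _ = W r := by simp only [hW, hc₂]; ring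
  have hW0 : 0 ≤ W r := by simp only [hW]; positivity
  have hWr : W r ≤ c₁ * r + c₂ := by
    simp only [hW]; nlinarith
  have hxbound : ∀ ξ ∈ ball (0 : Fin (s + 1) → ℂ) 1, 1 + ‖xf ξ‖ ≤ L * (1 + r) := by
    intro ξ hξ
    obtain ⟨-, -, hτ2, -⟩ := hτfacts ξ hξ
    have hw := hwbound ξ hξ
    have h1 : ‖xf ξ‖ ≤ ‖τf ξ‖ * ‖κc‖ + ‖wf ξ‖ := by
      simp only [hxf]
      exact (norm_add_le _ _).trans (add_le_add (norm_smul_le _ _) le_rfl)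
    rw [hL]
    nlinarith [norm_nonneg κc, norm_nonneg (wf ξ), norm_nonneg (τf ξ)]
  have hbound : ∀ j, ∀ ξ ∈ ball (0 : Fin (s + 1) → ℂ) 1, ‖G j ξ‖ ≤ ε := by
    intro j ξ hξ
    obtain ⟨hre, hτlo, hτhi, -⟩ := hτfacts ξ hξ
    have hτ1 : 1 ≤ ‖τf ξ‖ := by linarith
    have hx := hxbound ξ hξ
    have hw := hwbound ξ hξ
    have hw1 : (1 + ‖wf ξ‖) ≤ 1 + W r := by linarith
    have hxfe : xf ξ = τf ξ • κc + wf ξ := rfl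
    refine Fin.lastCases ?_ (fun j => ?_) j
    · -- the escaping coordinate
      simp only [hG, Fin.snoc_last, hGl]
      rw [norm_mul, norm_inv, ← div_eq_mul_inv, div_le_iff₀ hK₀pos, hK₀norm']
      have e1 : ‖τf ξ + α * τf ξ ^ D - eval (xf ξ) g‖ ≤
          2 * r + Cg * (1 + W r) ^ Ng * (2 * r) ^ (D - 1) := by
        rw [show τf ξ + α * τf ξ ^ D - eval (xf ξ) g =
            τf ξ - (eval (xf ξ) g - τf ξ ^ D * α) by ring]
        refine (norm_sub_le _ _).trans (add_le_add hτhi ?_)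
        rw [hxfe]
        refine (hCg (τf ξ) hτ1 (wf ξ)).trans ?_
        have e2 : (1 + ‖wf ξ‖) ^ Ng ≤ (1 + W r) ^ Ng := pow_le_pow_left₀ (by positivity) hw1 _
        have e3 : ‖τf ξ‖ ^ (D - 1) ≤ (2 * r) ^ (D - 1) :=
          pow_le_pow_left₀ (norm_nonneg _) hτhi _
        exact mul_le_mul (mul_le_mul_of_nonneg_left e2 hCg0) e3 (by positivity) (by positivity)
      refine e1.trans ?_
      obtain ⟨D', hD'⟩ : ∃ D', D = D' + 2 := ⟨D - 2, by omega⟩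
      have hDm : D - 1 = D' + 1 := by omega
      have hFl' : Fl r * (‖α‖ * r ^ D) ≤ ε * (‖α‖ * r ^ D) :=
        mul_le_mul_of_nonneg_right hFlε (by positivity)
      have hrpow : r ≤ r ^ (D' + 1) := by
        calc r = r ^ 1 := (pow_one r).symm
          _ ≤ r ^ (D' + 1) := pow_le_pow_right₀ hr1 (by omega)
      have hFlr : Fl r * (‖α‖ * r ^ D) =
          2 * r ^ (D' + 1) + Cg * (1 + W r) ^ Ng * (2 ^ (D' + 1) * r ^ (D' + 1)) := by
        simp only [hFl, hW]
        rw [hDm, hD', pow_zero]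
        field_simp
        ring
      have hC0 : 0 ≤ Cg * (1 + W r) ^ Ng * (2 ^ (D' + 1) * r ^ (D' + 1)) := by positivity
      rw [hDm, mul_pow]
      linarith
    · -- the fibre coordinates
      simp only [hG, Fin.snoc_castSucc, hGj]
      have hden : 0 < ‖t j‖ * ‖τf ξ‖ ^ d j := by
        have := norm_pos_iff.mpr (ht0 j); positivity
      rw [norm_mul, norm_inv, norm_mul, norm_pow, ← div_eq_mul_inv, div_le_iff₀ hden]
      -- numerator: top-coefficient term + exponentially small terms
      have e1 : ‖eval (xf ξ) (T j) - t j * τf ξ ^ d j‖ ≤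
          CT j * (1 + W r) ^ NT j * 2 ^ d j * r ^ d j / r := by
        rw [hxfe]
        refine (norm_top_sub_le (T j) κc (hCT0 j) (hCT j) hr2 hτlo hτhi (wf ξ)).trans ?_
        refine div_le_div_of_nonneg_right ?_ hr0
        refine mul_le_mul_of_nonneg_right (mul_le_mul_of_nonneg_right ?_ (by positivity))
          (by positivity)
        exact mul_le_mul_of_nonneg_left (pow_le_pow_left₀ (by positivity) hw1 _) (hCT0 j)
      set S : ℝ := ∑ i ∈ Finset.range (κ j),
        CA j i * L ^ NA j i * ((1 + r) ^ NA j i * Real.exp (-(r / 12))) with hS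
      have hS0 : 0 ≤ S := Finset.sum_nonneg fun i _ =>
        mul_nonneg (mul_nonneg (hCA0 j i) (pow_nonneg hL0 _)) (by positivity)
      have e2 : ‖∑ i ∈ Finset.range (κ j), eval (xf ξ) (A j i) *
          exp (-(((κ j - i : ℕ) : ℂ) * τf ξ))‖ ≤ S := by
        refine (norm_sum_le _ _).trans (Finset.sum_le_sum fun i hi => ?_)
        have hi' : i < κ j := Finset.mem_range.mp hi
        rw [norm_mul]
        have f1 : ‖eval (xf ξ) (A j i)‖ ≤ CA j i * L ^ NA j i * (1 + r) ^ NA j i := by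
          refine (hCA j i (xf ξ)).trans ?_
          rw [mul_assoc, ← mul_pow]
          exact mul_le_mul_of_nonneg_left (pow_le_pow_left₀ (by positivity) hx _) (hCA0 j i)
        have f2 : ‖exp (-(((κ j - i : ℕ) : ℂ) * τf ξ))‖ ≤ Real.exp (-(r / 12)) := by
          rw [Complex.norm_exp, Real.exp_le_exp]
          simp only [Complex.neg_re, Complex.mul_re, Complex.natCast_re, Complex.natCast_im,
            zero_mul, sub_zero]
          have hm : (1 : ℝ) ≤ ((κ j - i : ℕ) : ℝ) := by
            have : 1 ≤ κ j - i := by omega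
            exact_mod_cast this
          nlinarith
        calc ‖eval (xf ξ) (A j i)‖ * ‖exp (-(((κ j - i : ℕ) : ℂ) * τf ξ))‖
            ≤ (CA j i * L ^ NA j i * (1 + r) ^ NA j i) * Real.exp (-(r / 12)) :=
              mul_le_mul f1 f2 (norm_nonneg _)
                (mul_nonneg (mul_nonneg (hCA0 j i) (pow_nonneg hL0 _)) (pow_nonneg (by linarith) _))
          _ = CA j i * L ^ NA j i * ((1 + r) ^ NA j i * Real.exp (-(r / 12))) := by ring
      -- denominator: `‖τ‖^d ≥ (r/2)^d`
      have hτd : (r / 2) ^ d j ≤ ‖τf ξ‖ ^ d j := pow_le_pow_left₀ (by positivity) hτlo _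
      have hrd : 1 ≤ r ^ d j := one_le_pow₀ hr1
      have htn : 0 < ‖t j‖ := norm_pos_iff.mpr (ht0 j)
      have hFj : F j r * (‖t j‖ * (r / 2) ^ d j) =
          CT j * (1 + W r) ^ NT j * 2 ^ d j * r ^ d j / r + S * r ^ d j := by
        have h2r : (r / 2) ^ d j = r ^ d j / 2 ^ d j := div_pow r 2 (d j)
        simp only [hF, hW]
        rw [← hS, h2r]
        field_simp
        ring
      calc ‖eval (xf ξ) (T j) - t j * τf ξ ^ d j + ∑ i ∈ Finset.range (κ j),
              eval (xf ξ) (A j i) * exp (-(((κ j - i : ℕ) : ℂ) * τf ξ))‖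
          ≤ CT j * (1 + W r) ^ NT j * 2 ^ d j * r ^ d j / r + S :=
            (norm_add_le _ _).trans (add_le_add e1 e2)
        _ ≤ CT j * (1 + W r) ^ NT j * 2 ^ d j * r ^ d j / r + S * r ^ d j := by
            nlinarith
        _ = F j r * (‖t j‖ * (r / 2) ^ d j) := hFj.symm
        _ ≤ ε * (‖t j‖ * (r / 2) ^ d j) :=
            mul_le_mul_of_nonneg_right (hFε j) (by positivity)
        _ ≤ ε * (‖t j‖ * ‖τf ξ‖ ^ d j) :=
            mul_le_mul_of_nonneg_left (mul_le_mul_of_nonneg_left hτd htn.le) hεpos.le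
  have hε' : 16 * ((s + 1 : ℕ) + 1 : ℝ) * ε ≤ 1 := by
    rw [hε]; push_cast
    have : (16 : ℝ) * (s + 1 + 1) * (1 / (16 * (s + 2))) = 1 := by field_simp; ring
    rw [this]
  obtain ⟨ξ, hξ, hfix⟩ :=
    Literature.NumberTheory.Transcendental.ExpDominant.exists_exp_eq_one_add G hεpos.le hε'
      (fun j => (hG_diff j).differentiableOn) hbound
  set τ := τf ξ with hτdef
  set x := xf ξ with hxdef
  refine ⟨x, fun j => ?_⟩
  have hτD : α * τ ^ D = K₀ * exp (ξ (Fin.last s)) := by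
    have e : τ ^ D = τ₀ ^ D * exp (ξ (Fin.last s)) := by
      have hDi : (D : ℂ) * (ξ (Fin.last s) * (D : ℂ)⁻¹) = ξ (Fin.last s) := by field_simp
      rw [hτdef]
      simp only [hτf, hΛf, hτ₀, mul_pow, ← Complex.exp_nat_mul, hDi, Complex.exp_add,
        Complex.ofReal_log hr0, Complex.exp_log (by exact_mod_cast hrpos.ne' : (r : ℂ) ≠ 0)]
    rw [e, ← mul_assoc, hK₀eq]
  have hlast := hfix (Fin.last s)
  simp only [hG, Fin.snoc_last, hGl, ← hτdef, ← hxdef] at hlast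
  have hu : eval x g = τ + K₀ := by
    have hKt : ∀ z : ℂ, K₀ * (z * K₀⁻¹) = z := fun z => by field_simp
    have h1 : K₀ * exp (ξ (Fin.last s)) = K₀ + (τ + α * τ ^ D - eval x g) := by
      rw [hlast, mul_add, mul_one, hKt]
    rw [← hτD] at h1
    linear_combination h1
  have hexpu : exp (eval x g) = exp τ := by rw [hu, Complex.exp_add, hexpK₀, mul_one]
  have hj := hfix (Fin.castSucc j)
  simp only [hG, Fin.snoc_castSucc, hGj, ← hτdef, ← hxdef] at hj
  have hxj : x j = τ * κc j + ((d j : ℂ) * Λf ξ + ℓ j + ξ (Fin.castSucc j)) := by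
    rw [hxdef, hτdef]
    simp only [hxf, hwf, Pi.add_apply, Pi.smul_apply, smul_eq_mul]
  have hτpowd : exp ((d j : ℂ) * Λf ξ) = τ ^ d j := by
    rw [Complex.exp_nat_mul, hτdef]
  have hpow : ∀ i ∈ Finset.range (κ j),
      exp (τ * κc j) * exp (-(((κ j - i : ℕ) : ℂ) * τ)) = exp τ ^ i := by
    intro i hi
    have hi' : i ≤ κ j := (Finset.mem_range.mp hi).le
    rw [← Complex.exp_add, ← Complex.exp_nat_mul]
    congr 1
    simp only [hκc]
    push_cast [Nat.cast_sub hi']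
    ring
  have hκpow : exp (τ * κc j) = exp τ ^ κ j := by
    rw [← Complex.exp_nat_mul]; congr 1; simp only [hκc]; ring
  have hsum : exp (τ * κc j) * ∑ i ∈ Finset.range (κ j),
      eval x (A j i) * exp (-(((κ j - i : ℕ) : ℂ) * τ)) =
        ∑ i ∈ Finset.range (κ j), eval x (A j i) * exp τ ^ i := by
    rw [Finset.mul_sum]
    refine Finset.sum_congr rfl fun i hi => ?_
    rw [← hpow i hi]; ring
  have htτ : t j * τ ^ d j ≠ 0 := mul_ne_zero (ht0 j) (pow_ne_zero _ (hτf_ne ξ))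
  have hct : ∀ z : ℂ, t j * τ ^ d j * (z * (t j * τ ^ d j)⁻¹) = z := fun z => by
    rw [mul_comm z, ← mul_assoc, mul_inv_cancel₀ htτ, one_mul]
  rw [hexpu]
  calc exp (x j) = exp (τ * κc j) * (exp ((d j : ℂ) * Λf ξ) * exp (ℓ j) *
        exp (ξ (Fin.castSucc j))) := by
        rw [hxj, Complex.exp_add, Complex.exp_add, Complex.exp_add]
    _ = exp (τ * κc j) * (t j * τ ^ d j + (eval x (T j) - t j * τ ^ d j +
          ∑ i ∈ Finset.range (κ j), eval x (A j i) * exp (-(((κ j - i : ℕ) : ℂ) * τ)))) := by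
        rw [hτpowd, hexpℓ, hj, mul_add, mul_one, mul_comm (τ ^ d j) (t j), hct]
    _ = eval x (T j) * exp τ ^ κ j +
          ∑ i ∈ Finset.range (κ j), eval x (A j i) * exp τ ^ i := by
        rw [← hsum, ← hκpow]; ring

end Summit.Schanuel.Schanuel.Theorems
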